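import Summits.Ventures.HSemireg.WedgeHankelRecurrenceJacobi
import Summits.Ventures.HSemireg.WedgeHankelRecurrenceSignatureRank

/-!
# Venture HSemireg — HERMITE'S THEOREM BY DETERMINANTS over `ℝ`: for `P` monic real, `deg P ≤ t + 1`, `Q` any, and the Hankel determinants `Δ_k = det H_k(Q·P′/P)` (`k ≤ t`) all non-zero,
# **`TaQ(Q, P) = Σ_{x ∈ roots_ℝ P} sign Q(x) = Σ_{k ≤ t} sign(Δ_{k−1}Δ_k)`** (permanences − variations of `1, Δ_0, …, Δ_t`); for `Q = 1`: **#distinct real roots = P − V**, **#pairs of non-real roots = V**, and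
# **`P` is real-rooted ⟺ `Δ_0, …, Δ_t > 0`** — N138's Jacobi rule composed with N128 ∕ N129 ∕ N133 (BPR Thm. 4.57 over `ℝ`, `Sign = TaQ`, `sigNeg = #pairs`)

HONEST FRAMING. Part of the Lean index of the computation cell `pub-hsemireg` (seat p10 gen 34, Sunday typer «UNIFORM-IN-n»).
LINEAR ALGEBRA OF HANKEL (catalecticant) MATRICES AND REAL ∕ COMPLEX POLYNOMIALS ONLY (Mathlib's `sigPos` ∕ `sigNeg`, `Polynomial.roots` ∕ `aroots ℂ`, PROVED Literature `tarskiQuery`): no variety, no cohomology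
theory, no sheaf, no Ext group and no semiregularity map is constructed here; nothing here says that HC / HC_CM / HC_AV holds; no Literature fact is declared or used.  Custodian versions as in `WedgeHankelSiegelIdeal` (1/3).
SOURCE OF THE ARGUMENT (classical, cited not used): C. Hermite, *Sur le nombre des racines d'une équation algébrique comprises entre des limites données*, J. reine angew. Math. 52 (1856) 39–51; C. W. Borchardt
(1847) ∕ C. G. J. Jacobi (1857) for the determinant form; F. R. Gantmacher, *The Theory of Matrices* II, Ch. XV §11 («the number of distinct real roots equals the signature of the Hankel form
`S(x, x) = Σ s_{i+k} x_i x_k` of the Newton sums …», with Ch. X §3 Jacobi's rule to read the signature off `D_1, …, D_n`); S. Basu, R. Pollack, M.-F. Roy, *Algorithms in Real Algebraic Geometry*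
(2nd ed. 2006) §4.3.2 Thm. 4.57 ∕ Rem. 4.59 and §9.1.
DEDUP DISCLOSURE (`rg` of the whole tree + Mathlib, 2026-09-01): PROVED Literature `Algebra/Polynomial/HermiteRankSignature.lean` ∕ `HermiteRealRootedness.lean` give the ROOT COUNTS as `sigPos`∕`sigNeg`∕eigenvalue
counts and real-rootedness as `Matrix.PosSemidef` of the Hermite matrix (no determinants); `TarskiQuery` ∕ `SturmTheorem` ∕ `CauchyIndex` count by Sturm sequences; N133 has real-rootedness ⟺ `sigNeg = 0`;
nowhere in the tree is a root count or a real-rootedness criterion expressed through the LEADING PRINCIPAL MINORS `Δ_k` of the Hankel matrix — that is this file (via N138).  7 names: 0 hits tree-wide.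

WHAT IS IN THE TREE.  N138 (`WedgeHankelRecurrenceJacobi`): `sigPos_sigNeg_eq_card_filter_det_mul_det`, `sigPos_sub_sigNeg_eq_sum_sign_det_mul_det`, `sigPos_sigNeg_hankelSq_eq_card_filter`, `hankelSq_eq_of`.
N129 (`WedgeHankelRecurrenceSignatureSturm`): `sigPos_sub_sigNeg_hankelSq_dualSeq_mul_derivative_real` (`= Σ_{x} sign Q(x)`), `tarskiQuery_eq_sum_sign`.  N133 (`WedgeHankelRecurrenceSignatureRank`):
`sigNeg_hankelSq_dualSeq_derivative_real_eq_card_upper`, `splits_iff_sigNeg_hankelSq_eq_zero`.  Mathlib: `Matrix.det_fin_zero`, `sign_one`, `Finset.filter_eq_empty_iff`.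
THIS FILE (namespace `Summit.Ventures.HSemireg.Wedge.HankelOuter` continued; CHAINED on N138, PLAIN on N133 (hence N129, N128, N127); 0 definitions; `Δ_{k−1}Δ_k` is written
`det (of (i j : Fin k) ↦ q_{i+j}) * det (hankelSq ℝ k q)`, the first factor being `1` for `k = 0`):
* §732 **`sum_sign_eval_roots_eq_sum_sign_det`** (HERMITE: `Σ_{x ∈ roots_ℝ P} sign Q(x) = Σ_{k ≤ t} sign(Δ_{k−1}Δ_k)`), **`tarskiQuery_eq_sum_sign_det`** (the same with Literature's `tarskiQuery Q P a b`, all roots in `(a, b)`).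
* §733 (`Q = 1`) **`card_roots_toFinset_eq_sum_sign_det`** (#distinct real roots = permanences − variations), **`card_upper_roots_eq_card_filter_det`** (#conjugate pairs = #variations), `forall_mul_pos_iff_forall_pos`,
  **`splits_iff_forall_det_hankelSq_pos`** (all `Δ_k ≠ 0`: real-rooted ⟺ all `Δ_k > 0`), `splits_of_forall_det_hankelSq_pos` (all `Δ_k > 0` ⇒ real-rooted).
CAVEATS.  `R = ℝ`, `C = ℂ` as in N128 (Mathlib has no abstract real closed field); `P` MONIC; the hypothesis «all `Δ_k ≠ 0`, `k ≤ t`» is essential for Jacobi's count (for `t + 1 > #distinct complex roots`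
`Δ_t = 0`, so in practice `t + 1 = #Zer(P, ℂ)`, e.g. `deg P` for `P` separable — N113 ∕ N133 give `rank`); the Gundelfinger ∕ Frobenius rules for vanishing minors are not typed.
Nothing Ext-side.  New names only.
-/

open Module Polynomial
open scoped Matrix Polynomial

namespace Summit.Ventures.HSemireg.Wedge.HankelOuter

open Summit.Ventures.HSemireg.Wedge Summit.Ventures.HSemireg.Wedge.Hankel

/-! ## §732. Hermite's theorem by determinants over `ℝ`: `TaQ(Q, P) = (permanences) − (variations)` of `1, Δ_0, …, Δ_t`, `Δ_k = det H_k(Q·P′/P)` -/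

/-- **HERMITE 1856 BY DETERMINANTS: for `P` monic real of degree `≤ t + 1`, any `Q`, and all Hankel determinants `Δ_k = det H_k(Q·P′/P)` (`k ≤ t`) non-zero,
`Σ_{x ∈ roots_ℝ(P)} sign Q(x) = Σ_{k ≤ t} sign(Δ_{k−1} Δ_k)`** (`Δ_{−1} = 1`; the Tarski query of `Q` on the real roots of `P` is the number of sign permanences minus the number of sign variations; N129
`Sign(Her(P,Q)) = TaQ(Q,P)` + N138 Jacobi). [this file, §732] -/
theorem sum_sign_eval_roots_eq_sum_sign_det {t : ℕ} {P : ℝ[X]} (hP : P.Monic) (hPd : P.natDegree ≤ t + 1) (Q : ℝ[X]) (hD : ∀ k, k ≤ t → (hankelSq ℝ k (dualSeq ℝ P (Q * derivative P))).det ≠ 0) :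
    ∑ x ∈ P.roots.toFinset, (SignType.sign (Q.eval x) : ℤ)
      = ∑ k ∈ Finset.range (t + 1), (SignType.sign ((Matrix.of fun i j : Fin k => dualSeq ℝ P (Q * derivative P) ((i : ℕ) + (j : ℕ))).det * (hankelSq ℝ k (dualSeq ℝ P (Q * derivative P))).det) : ℤ) := by
  have hD' : ∀ k, k ≤ t + 1 → (Matrix.of fun i j : Fin k => dualSeq ℝ P (Q * derivative P) ((i : ℕ) + (j : ℕ))).det ≠ 0 := by
    intro k hk
    rcases k with _ | k
    · rw [Matrix.det_fin_zero]; exact one_ne_zero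
    · exact hD k (Nat.succ_le_succ_iff.1 hk)
  rw [← sigPos_sub_sigNeg_hankelSq_dualSeq_mul_derivative_real hP hPd Q, hankelSq_eq_of,
    sigPos_sub_sigNeg_eq_sum_sign_det_mul_det (S := fun i j => dualSeq ℝ P (Q * derivative P) (i + j)) (fun i j => by rw [add_comm]) (t + 1) hD']
  rfl

/-- **… and with the tree's Sturm–Tarski count: `TaQ(Q, P; a, b) = Σ_{k ≤ t} sign(Δ_{k−1} Δ_k)`** when all real roots of `P` lie in `(a, b)` (Literature `tarskiQuery`, via N129). [this file, §732] -/
theorem tarskiQuery_eq_sum_sign_det {t : ℕ} {P : ℝ[X]} (hP : P.Monic) (hPd : P.natDegree ≤ t + 1) (Q : ℝ[X]) {a b : ℝ} (hab : ∀ x ∈ P.roots, a < x ∧ x < b)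
    (hD : ∀ k, k ≤ t → (hankelSq ℝ k (dualSeq ℝ P (Q * derivative P))).det ≠ 0) :
    Literature.Algebra.Polynomial.tarskiQuery Q P a b
      = ∑ k ∈ Finset.range (t + 1), (SignType.sign ((Matrix.of fun i j : Fin k => dualSeq ℝ P (Q * derivative P) ((i : ℕ) + (j : ℕ))).det * (hankelSq ℝ k (dualSeq ℝ P (Q * derivative P))).det) : ℤ) := by
  rw [tarskiQuery_eq_sum_sign P Q hab, sum_sign_eval_roots_eq_sum_sign_det hP hPd Q hD]

/-! ## §733. `Q = 1`: distinct real roots = permanences − variations, conjugate pairs = variations; real-rootedness ⟺ all `Δ_k > 0` -/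

/-- **The NUMBER OF DISTINCT REAL ROOTS of a monic real `P` (`deg P ≤ t + 1`) is `Σ_{k ≤ t} sign(Δ_{k−1}Δ_k)` = (permanences) − (variations) of `1, Δ_0, …, Δ_t`, `Δ_k = det H_k(P′/P)` the Hankel determinants
of the Newton sums, all assumed non-zero** (Hermite ∕ Jacobi–Borchardt). [this file, §733] -/
theorem card_roots_toFinset_eq_sum_sign_det {t : ℕ} {P : ℝ[X]} (hP : P.Monic) (hPd : P.natDegree ≤ t + 1) (hD : ∀ k, k ≤ t → (hankelSq ℝ k (dualSeq ℝ P (derivative P))).det ≠ 0) :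
    (P.roots.toFinset.card : ℤ) = ∑ k ∈ Finset.range (t + 1), (SignType.sign ((Matrix.of fun i j : Fin k => dualSeq ℝ P (derivative P) ((i : ℕ) + (j : ℕ))).det * (hankelSq ℝ k (dualSeq ℝ P (derivative P))).det) : ℤ) := by
  have h := sum_sign_eval_roots_eq_sum_sign_det hP hPd 1 (by simpa only [one_mul] using hD)
  simp only [one_mul, eval_one, sign_one, SignType.coe_one, Finset.sum_const, nsmul_eq_mul, mul_one] at h
  rw [← h]

/-- **The NUMBER OF PAIRS OF NON-REAL ROOTS (distinct, counted once per pair) is the number of sign VARIATIONS in `1, Δ_0, …, Δ_t`** and the number of distinct roots in `ℂ` is the number of permanences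
plus the number of variations (`Δ_k = det H_k(P′/P)` all non-zero; N133 `sigNeg H_t(P′/P) = #pairs` + Jacobi). [this file, §733] -/
theorem card_upper_roots_eq_card_filter_det {t : ℕ} {P : ℝ[X]} (hP : P.Monic) (hPd : P.natDegree ≤ t + 1) (hD : ∀ k, k ≤ t → (hankelSq ℝ k (dualSeq ℝ P (derivative P))).det ≠ 0) :
    ((P.aroots ℂ).toFinset.filter fun z => 0 < z.im).card
      = ((Finset.range (t + 1)).filter fun k => (Matrix.of fun i j : Fin k => dualSeq ℝ P (derivative P) ((i : ℕ) + (j : ℕ))).det * (hankelSq ℝ k (dualSeq ℝ P (derivative P))).det < 0).card := by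
  rw [← sigNeg_hankelSq_dualSeq_derivative_real_eq_card_upper hP hPd, (sigPos_sigNeg_hankelSq_eq_card_filter t _ hD).2]

/-- From `D_0 = 1 > 0`: all consecutive products `D_k D_{k+1}` (`k ≤ t`) are positive iff all `D_{k+1}` (`k ≤ t`) are positive. [bookkeeping] -/
theorem forall_mul_pos_iff_forall_pos {K : Type*} [Field K] [LinearOrder K] [IsStrictOrderedRing K] (D : ℕ → K) (h0 : D 0 = 1) (t : ℕ) :
    (∀ k, k ≤ t → 0 < D k * D (k + 1)) ↔ ∀ k, k ≤ t → 0 < D (k + 1) := by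
  constructor
  · intro h
    have key : ∀ k, k ≤ t → 0 < D k ∧ 0 < D (k + 1) := by
      intro k
      induction k with
      | zero => intro _; have h1 := h 0 (Nat.zero_le _); rw [h0, one_mul] at h1; exact ⟨by rw [h0]; exact one_pos, h1⟩
      | succ k ih =>
        intro hk
        have hk' := (ih (Nat.le_of_succ_le hk)).2
        exact ⟨hk', (pos_iff_pos_of_mul_pos (h (k + 1) hk)).1 hk'⟩
    exact fun k hk => (key k hk).2
  · intro h k hk
    rcases k with _ | k
    · rw [h0, one_mul]; exact h 0 hk
    · exact mul_pos (h k (Nat.le_of_succ_le hk)) (h (k + 1) hk)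

/-- **REAL-ROOTEDNESS BY HANKEL DETERMINANTS: for `P` monic real of degree `≤ t + 1` with all `Δ_k = det H_k(P′/P)` (`k ≤ t`) non-zero, `P` splits over `ℝ` iff `Δ_0, …, Δ_t` are all POSITIVE** (N133: `P` splits ⟺
`sigNeg H_t(P′/P) = 0` ⟺ no sign variation; with `Δ_{−1} = 1` no variation means all positive). [this file, §733] -/
theorem splits_iff_forall_det_hankelSq_pos {t : ℕ} {P : ℝ[X]} (hP : P.Monic) (hPd : P.natDegree ≤ t + 1) (hD : ∀ k, k ≤ t → (hankelSq ℝ k (dualSeq ℝ P (derivative P))).det ≠ 0) :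
    P.Splits ↔ ∀ k, k ≤ t → 0 < (hankelSq ℝ k (dualSeq ℝ P (derivative P))).det := by
  rw [splits_iff_sigNeg_hankelSq_eq_zero hP hPd, (sigPos_sigNeg_hankelSq_eq_card_filter t _ hD).2, Finset.card_eq_zero, Finset.filter_eq_empty_iff]
  have hD' : ∀ k, k ≤ t + 1 → (Matrix.of fun i j : Fin k => dualSeq ℝ P (derivative P) ((i : ℕ) + (j : ℕ))).det ≠ 0 := by
    intro k hk
    rcases k with _ | k
    · rw [Matrix.det_fin_zero]; exact one_ne_zero
    · exact hD k (Nat.succ_le_succ_iff.1 hk)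
  have key := forall_mul_pos_iff_forall_pos (fun k => (Matrix.of fun i j : Fin k => dualSeq ℝ P (derivative P) ((i : ℕ) + (j : ℕ))).det) Matrix.det_fin_zero t
  constructor
  · intro h k hk
    refine (key.1 fun k hk => ?_) k hk
    have hne := mul_ne_zero (hD' k (Nat.le_succ_of_le hk)) (hD' (k + 1) (Nat.succ_le_succ hk))
    exact (hne.lt_or_gt).resolve_left (h (Finset.mem_range.2 (Nat.lt_succ_of_le hk)))
  · intro h k hk
    exact not_lt.2 (key.2 h k (Nat.le_of_lt_succ (Finset.mem_range.1 hk))).le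

/-- **All `Δ_0, …, Δ_t > 0` ⇒ `P` splits over `ℝ`** (no non-vanishing hypothesis needed: positivity is it). [this file, §733] -/
theorem splits_of_forall_det_hankelSq_pos {t : ℕ} {P : ℝ[X]} (hP : P.Monic) (hPd : P.natDegree ≤ t + 1) (hD : ∀ k, k ≤ t → 0 < (hankelSq ℝ k (dualSeq ℝ P (derivative P))).det) : P.Splits :=
  (splits_iff_forall_det_hankelSq_pos hP hPd fun k hk => (hD k hk).ne').2 hD

end Summit.Ventures.HSemireg.Wedge.HankelOuter
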